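import Literature.NumberTheory.Automorphic.SelfDualStableLatticeCountNormalized      -- ★ (L5-d3) B-p10: strata membership, `ncard_selfDualStable_smul_one_diag_eq_sum`, per-stratum value
import Literature.NumberTheory.Automorphic.PlaneLatticesCompanionScalarReduction       -- ★ B-p08: `map_le_map_smul_one_iff` (`A·Λ(g) ≤ c·Λ(g)` in coordinates)
import HarnessLib

/-!
# LEVEL-`i` BALL COUNTS of self-dual `γ`-stable lattices in a hermitian plane: `#{Λ ∈ S(ϖ^e·1, diag(a,c)) | (γ − s·1)Λ ⊆ ϖ^i Λ} = Σ_{j + i ≤ N, j ≡ e (2)} w(j)`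
# (`w(0) = 1`, `w(j) = q^{j−1}(q+1)`, `N = v(a − c)`; Flicker 1998 §6 p. 95 — the fixed ball of radius `N − i` on the `(q+1)`-regular tree)

Topic `NumberTheory/Automorphic`; namespace `Literature.NumberTheory.Automorphic`.  THEOREMS ONLY (no definition, no instance, no notation, no named fact,
no `sorry`).  Cell `pub/hodgecm-mathlib`, F0∕P3a road «R1LL-tree» (in-house pay-down of the (R1-CM) letter; LEAD F0P3a-plan (g10) WORD T9-8 (A); architect
A-p16 (g27) census 75cd9948 §4 brick **(G2-B)**; B-p12 (g29) census 86286e4d §3 «depth counts» I-2 — the same object), hand A-p13 (g31).  HC_CM is proved only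
modulo the printed citations until rung 0 closes; nothing printed is a letter here — elementary lattice algebra over a discrete valuation ring.

THE SET AND THE LEVEL PREDICATE.  `S(ϖ^e • 1, γ)` is the socket's set of `γ`-stable self-dual lattices, token-exact as in ★ (L5-d3)
`ncard_selfDualStable_smul_one_diag_eq_sum` (`↑γ = !![a, 0; 0, c]`, `|a| = |c| = 1`, `|a − c| = |ϖ^N|`, `e ≤ 1`).  For a scalar `s : F` and a level `i : ℕ` the
LEVEL PREDICATE «`γ` acts as the scalar `s` on `Λ ⁄ ϖ^i Λ`» is written in ★ B-p08's token
`Λ.map (toLin' (↑γ − s • 1)) ≤ Λ.map (toLin' (ϖ^i • 1))` (restricted to `𝒪`-scalars).  On the tree of `U(1,1)` this says: the vertex `Λ` lies in the ball of radius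
`N − i` about the vertex fixed by the torus, i.e. `γ ∈ s·K_i(Λ)` (principal congruence subgroup of level `i` of the stabiliser of `Λ`).

* §1 `coe_inv_mul_sub_smul_one_mul_of_upperTriangular` — `g⁻¹ (γ − s·1) g = !![a − s, P⁻¹(a − c)y; 0, c − s]` for `↑g = !![P, y; 0, Q]`.
* §2 `map_sub_smul_one_le_iff_of_hermite` — for a Hermite lattice `Λ(T(k,y,l))`: level predicate `↔ ϖ^{−i}(a − s), ϖ^{−i}(c − s), ϖ^{−i}ϖ^{−k}(a − c)y ∈ 𝒪`.
* §3 **`map_sub_smul_one_le_iff_of_selfDual`** — for a SELF-DUAL Hermite lattice `Λ(T(k,y,−k−e))` (`j = 2k + e`): level predicate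
  `↔ ϖ^{−i}(a − s) ∈ 𝒪 ∧ ϖ^{−i}(c − s) ∈ 𝒪 ∧ 2k + e + i ≤ N` («`t` is the scalar `s` on `Λ⁄ϖ^iΛ` iff `Λ` is at distance `≤ N − i` from the fixed vertex»;
  `j ≥ 1`: the `u`-coordinate is a unit, ★ (L5-b); `j = 0`: automatic); `mem_selfDualStable_smul_one_diag_level_iff` — membership through the strata.
* §4 **`ncard_selfDualStable_smul_one_diag_level_eq_sum`** — under `ϖ^{−i}(a − s), ϖ^{−i}(c − s) ∈ 𝒪`:
  `#{Λ ∈ S(ϖ^e • 1, γ) | level predicate} = ∑ j ∈ (range (N+1)).filter (j % 2 = e ∧ j + i ≤ N), w q j` (the strata proof of ★ (L5-d3) with one more conjunct);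
  hypothesis-free corollaries `…_level_self_eq_sum` (`s := c`, B-p12's rescaled-element reading) and `…_level_self_eq_sum'` (`s := a`, A-p16's `γ₁`-reading),
  valid for EVERY `i` (for `i > N` both sides vanish).

## References
* [Flicker1998UnitaryFL] Y. Z. Flicker, *Elementary proof of the fundamental lemma for a unitary group*, Canad. J. Math. 50 (1998), §6 p. 95 + REMARK.
* [Kottwitz1988] R. E. Kottwitz, *Tamagawa numbers*, Ann. of Math. 127 (1988), §2 (counting fixed points on buildings level by level).
* [Macdonald1995] I. G. Macdonald, *Symmetric functions and Hall polynomials* (1995), Ch. V §2.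
* [Serre1980Trees] J.-P. Serre, *Trees* (1980), Ch. II §1.1 (the tree of `SL₂` over a local field; balls and stabilisers).
-/

set_option autoImplicit false

noncomputable section

open scoped ValuativeRel Matrix MatrixGroups
open Matrix ValuativeRel Finset IsLocalRing

namespace Literature.NumberTheory.Automorphic

variable {F : Type*} [Field F] [ValuativeRel F] (σ : F →+* F) {ϖ : F} (hϖ : IsUniformizingElement ϖ)

/-! ## §1 The matrix of `γ − s·1` in a Hermite basis -/

section Coordinates

omit [ValuativeRel F] in
/-- **`g⁻¹ (γ − s·1) g = !![a − s, P⁻¹((a − c) y); 0, c − s]`** for `↑γ = diag(a, c)` and `↑g = !![P, y; 0, Q]` (★ `upperTriangular_inv_mul_diag_mul` minus the scalar).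
[cite: Macdonald1995, Ch. V §2] -/
theorem coe_inv_mul_sub_smul_one_mul_of_upperTriangular {P Q y a c : F} (hP : P ≠ 0) (hQ : Q ≠ 0) (s : F) (γ g : GL (Fin 2) F)
    (hγ : (γ : Matrix (Fin 2) (Fin 2) F) = !![a, 0; 0, c]) (hg : (g : Matrix (Fin 2) (Fin 2) F) = !![P, y; 0, Q]) :
    ((g⁻¹ : GL (Fin 2) F) : Matrix (Fin 2) (Fin 2) F) * ((γ : Matrix (Fin 2) (Fin 2) F) - s • (1 : Matrix (Fin 2) (Fin 2) F)) *
        (g : Matrix (Fin 2) (Fin 2) F) = !![a - s, P⁻¹ * ((a - c) * y); 0, c - s] := by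
  have hconj : ((g⁻¹ : GL (Fin 2) F) : Matrix (Fin 2) (Fin 2) F) * (γ : Matrix (Fin 2) (Fin 2) F) * (g : Matrix (Fin 2) (Fin 2) F) =
      !![a, P⁻¹ * ((a - c) * y); 0, c] := by
    rw [Matrix.coe_units_inv, hg, hγ, upperTriangular_inv_mul_diag_mul hP hQ]
  rw [Matrix.mul_sub, Matrix.sub_mul, hconj, Matrix.mul_smul, Matrix.mul_one, Matrix.smul_mul, ← Units.val_mul, inv_mul_cancel,
    Units.val_one, Matrix.one_fin_two]
  ext i j
  fin_cases i <;> fin_cases j <;> simp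

end Coordinates

/-! ## §2 The level predicate for a Hermite lattice, in coordinates -/

section Hermite

include hϖ in
/-- **LEVEL PREDICATE IN HERMITE COORDINATES**: for `↑γ = diag(a, c)`, `↑g = T(k, y, l)`, a scalar `s` and a level `i`,
`(γ − s·1)·Λ(g) ≤ ϖ^i·Λ(g) ↔ ϖ^{−i}(a − s) ∈ 𝒪 ∧ ϖ^{−i}(c − s) ∈ 𝒪 ∧ ϖ^{−i}·ϖ^{−k}(a − c)y ∈ 𝒪` (★ `map_le_map_smul_one_iff`: the matrix
`ϖ^{−i}·g⁻¹(γ − s·1)g = ϖ^{−i}·!![a − s, ϖ^{−k}(a − c)y; 0, c − s]` is integral). [cite: Macdonald1995, Ch. V §2] [cite: Kottwitz1988, §2] -/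
theorem map_sub_smul_one_le_iff_of_hermite {k l : ℤ} {y a c : F} (s : F) (i : ℕ) (γ g : GL (Fin 2) F)
    (hγ : (γ : Matrix (Fin 2) (Fin 2) F) = !![a, 0; 0, c]) (hg : (g : Matrix (Fin 2) (Fin 2) F) = !![ϖ ^ k, y; 0, ϖ ^ l]) :
    (Submodule.span 𝒪[F] (Set.range ((g : Matrix (Fin 2) (Fin 2) F))ᵀ)).map
          ((Matrix.toLin' ((γ : Matrix (Fin 2) (Fin 2) F) - s • (1 : Matrix (Fin 2) (Fin 2) F))).restrictScalars 𝒪[F]) ≤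
        (Submodule.span 𝒪[F] (Set.range ((g : Matrix (Fin 2) (Fin 2) F))ᵀ)).map
          ((Matrix.toLin' (ϖ ^ i • (1 : Matrix (Fin 2) (Fin 2) F))).restrictScalars 𝒪[F]) ↔
      ϖ ^ (-(i : ℤ)) * (a - s) ∈ 𝒪[F] ∧ ϖ ^ (-(i : ℤ)) * (c - s) ∈ 𝒪[F] ∧ ϖ ^ (-(i : ℤ)) * (ϖ ^ (-k) * ((a - c) * y)) ∈ 𝒪[F] := by
  have h0 := hϖ.ne_zero
  rw [map_le_map_smul_one_iff g _ (pow_ne_zero i h0),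
    coe_inv_mul_sub_smul_one_mul_of_upperTriangular (zpow_ne_zero k h0) (zpow_ne_zero l h0) s γ g hγ hg,
    show (ϖ ^ i : F)⁻¹ = ϖ ^ (-(i : ℤ)) by rw [_root_.zpow_neg, zpow_natCast], ← _root_.zpow_neg]
  constructor
  · intro h
    refine ⟨?_, ?_, ?_⟩
    · simpa only [Matrix.smul_apply, Matrix.of_apply, Matrix.cons_val', Matrix.cons_val_zero, Matrix.cons_val_fin_one, smul_eq_mul] using h 0 0
    · simpa only [Matrix.smul_apply, Matrix.of_apply, Matrix.cons_val', Matrix.cons_val_one, Matrix.cons_val_fin_one, smul_eq_mul] using h 1 1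
    · simpa only [Matrix.smul_apply, Matrix.of_apply, Matrix.cons_val', Matrix.cons_val_zero, Matrix.cons_val_one, Matrix.cons_val_fin_one,
        smul_eq_mul] using h 0 1
  · rintro ⟨h1, h2, h3⟩ i' j'
    fin_cases i' <;> fin_cases j'
    · simpa only [Fin.zero_eta, Matrix.smul_apply, Matrix.of_apply, Matrix.cons_val', Matrix.cons_val_zero, Matrix.cons_val_fin_one,
        smul_eq_mul] using h1
    · simpa only [Fin.zero_eta, Fin.mk_one, Matrix.smul_apply, Matrix.of_apply, Matrix.cons_val', Matrix.cons_val_zero, Matrix.cons_val_one,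
        Matrix.cons_val_fin_one, smul_eq_mul] using h3
    · simp only [Fin.zero_eta, Fin.mk_one, Matrix.smul_apply, Matrix.of_apply, Matrix.cons_val', Matrix.cons_val_zero, Matrix.cons_val_one,
        Matrix.cons_val_fin_one, smul_eq_mul, mul_zero]
      exact zero_mem _
    · simpa only [Fin.mk_one, Matrix.smul_apply, Matrix.of_apply, Matrix.cons_val', Matrix.cons_val_one, Matrix.cons_val_fin_one,
        smul_eq_mul] using h2

end Hermite

/-! ## §3 The level predicate on the self-dual strata: «distance `≤ N − i` from the fixed vertex» -/

section Strata

variable {σ}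
variable (hσϖ : σ ϖ = ϖ) (hσO : ∀ x ∈ 𝒪[F], σ x ∈ 𝒪[F]) {e : ℕ}
  {a c : F} {N : ℕ} (γ : GL (Fin 2) F) (hγ : (γ : Matrix (Fin 2) (Fin 2) F) = !![a, 0; 0, c])
  (ha : valuation F a = 1) (hc : valuation F c = 1) (hN : valuation F (a - c) = valuation F (ϖ ^ N))

include hϖ hN in
/-- **The level cannot exceed the gap**: `ϖ^{−i}(a − s), ϖ^{−i}(c − s) ∈ 𝒪` force `i ≤ N = v(a − c)` (subtract: `ϖ^{−i}(a − c) ∈ 𝒪`). [cite: Flicker1998UnitaryFL, §6 p. 95] -/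
theorem le_of_zpow_neg_mul_sub_mem {s : F} {i : ℕ} (has : ϖ ^ (-(i : ℤ)) * (a - s) ∈ 𝒪[F]) (hcs : ϖ ^ (-(i : ℤ)) * (c - s) ∈ 𝒪[F]) :
    i ≤ N := by
  have h0 := hϖ.ne_zero
  have hac : ϖ ^ (-(i : ℤ)) * (a - c) ∈ 𝒪[F] := by
    have := Subring.sub_mem _ has hcs
    rwa [← mul_sub, sub_sub_sub_cancel_right] at this
  have hval : valuation F (ϖ ^ (-(i : ℤ)) * (a - c)) = valuation F (ϖ ^ ((N : ℤ) - i)) := by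
    rw [map_mul, hN, ← map_mul, ← zpow_natCast, ← zpow_add₀ h0, neg_add_eq_sub]
  have hmem : ϖ ^ ((N : ℤ) - i) ∈ 𝒪[F] := by
    rw [Valuation.mem_integer_iff, ← hval, ← Valuation.mem_integer_iff]; exact hac
  have := (zpow_uniformizer_mem_integer_iff hϖ _).1 hmem
  omega

include hϖ hσϖ hσO hγ hN in
/-- **LEVEL PREDICATE ON A SELF-DUAL STRATUM ⟺ `2k + e + i ≤ N`** (given the scalar conditions): for `↑γ = diag(a, c)`, `|a| = |c| = 1`, `|a − c| = |ϖ^N|`,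
`↑g = T(k, y, −k−e)` self-dual for `ϖ^e · 1` (`j := 2k + e` = the distance of `Λ(g)` from the vertex fixed by the diagonal torus):
`(γ − s·1)·Λ(g) ≤ ϖ^i·Λ(g) ↔ ϖ^{−i}(a − s) ∈ 𝒪 ∧ ϖ^{−i}(c − s) ∈ 𝒪 ∧ j + i ≤ N` — for `j ≥ 1` the `u`-coordinate `u = ϖ^{k+e}y` is a unit (★ (L5-b)
`valuation_eq_one_of_norm_congr`) and `|ϖ^{−i}ϖ^{−k}(a − c)y| = |ϖ^{N − j − i}|`; for `j = 0` the off-diagonal condition follows from the diagonal ones.  This is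
«`γ` fixes the ball `B(Λ, i)` pointwise (acts on `Λ⁄ϖ^iΛ` as the scalar `s`) iff `B(Λ, i) ⊆ B(x_T, N)`». [cite: Flicker1998UnitaryFL, §6 p. 95] [cite: Kottwitz1988, §2]
[cite: Serre1980Trees, Ch. II §1.1] -/
theorem map_sub_smul_one_le_iff_of_selfDual (s : F) (i : ℕ) {k : ℤ} {y : F} (g : GL (Fin 2) F)
    (hg : (g : Matrix (Fin 2) (Fin 2) F) = !![ϖ ^ k, y; 0, ϖ ^ (-k - e)])
    (hsd : ∃ J' ∈ glInt 2 F, (J' : Matrix (Fin 2) (Fin 2) F) = formCongr σ g ((ϖ ^ (e : ℤ)) • (1 : Matrix (Fin 2) (Fin 2) F))) :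
    (Submodule.span 𝒪[F] (Set.range ((g : Matrix (Fin 2) (Fin 2) F))ᵀ)).map
          ((Matrix.toLin' ((γ : Matrix (Fin 2) (Fin 2) F) - s • (1 : Matrix (Fin 2) (Fin 2) F))).restrictScalars 𝒪[F]) ≤
        (Submodule.span 𝒪[F] (Set.range ((g : Matrix (Fin 2) (Fin 2) F))ᵀ)).map
          ((Matrix.toLin' (ϖ ^ i • (1 : Matrix (Fin 2) (Fin 2) F))).restrictScalars 𝒪[F]) ↔
      ϖ ^ (-(i : ℤ)) * (a - s) ∈ 𝒪[F] ∧ ϖ ^ (-(i : ℤ)) * (c - s) ∈ 𝒪[F] ∧ 2 * k + e + i ≤ N := by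
  have h0 := hϖ.ne_zero
  rw [map_sub_smul_one_le_iff_of_hermite hϖ s i γ g hγ hg]
  refine and_congr_right fun has => and_congr_right fun hcs => ?_
  have hiN : i ≤ N := le_of_zpow_neg_mul_sub_mem hϖ hN has hcs
  obtain ⟨-, hj, hu, hcong⟩ := (exists_mem_glInt_coe_eq_formCongr_hermite_iff hϖ σ hσϖ hσO g hg).1 hsd
  rcases (show 2 * k + (e : ℤ) = 0 ∨ 1 ≤ 2 * k + (e : ℤ) by omega) with hj0 | hj1
  · -- `j = 0`: `−k = k + e`, `u = ϖ^{−k} y ∈ 𝒪`, and `ϖ^{−i}(a − c) ∈ 𝒪` by subtraction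
    have hke : -k = k + (e : ℤ) := by omega
    refine iff_of_true ?_ (by omega)
    have hac : ϖ ^ (-(i : ℤ)) * (a - c) ∈ 𝒪[F] := by
      have := Subring.sub_mem _ has hcs
      rwa [← mul_sub, sub_sub_sub_cancel_right] at this
    rw [hke, show ϖ ^ (-(i : ℤ)) * (ϖ ^ (k + (e : ℤ)) * ((a - c) * y)) = ϖ ^ (-(i : ℤ)) * (a - c) * (ϖ ^ (k + (e : ℤ)) * y) by ring]
    exact Subring.mul_mem _ hac hu
  · -- `j ≥ 1`: the `u`-coordinate is a unit
    have hu1 : valuation F (ϖ ^ (k + e) * y) = 1 := valuation_eq_one_of_norm_congr hϖ σ hσO hj1 hu hcong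
    have hy : valuation F y = valuation F (ϖ ^ (-(k + (e : ℤ)))) := by
      have e1 : y = ϖ ^ (-(k + (e : ℤ))) * (ϖ ^ (k + e) * y) := by
        rw [← mul_assoc, ← zpow_add₀ h0, neg_add_cancel, zpow_zero, one_mul]
      rw [e1, map_mul, hu1, mul_one]
    have hval : valuation F (ϖ ^ (-(i : ℤ)) * (ϖ ^ (-k) * ((a - c) * y))) = valuation F (ϖ ^ ((N : ℤ) - (2 * k + e + i))) := by
      rw [map_mul, map_mul, map_mul, hN, hy, ← map_mul, ← map_mul, ← map_mul, ← zpow_natCast, ← zpow_add₀ h0, ← zpow_add₀ h0,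
        ← zpow_add₀ h0]
      congr 2
      ring
    rw [Valuation.mem_integer_iff, hval, ← Valuation.mem_integer_iff, zpow_uniformizer_mem_integer_iff hϖ]
    omega

include hϖ hσϖ hσO hγ ha hc hN in
/-- **MEMBERSHIP THROUGH THE STRATA**: under `ϖ^{−i}(a − s), ϖ^{−i}(c − s) ∈ 𝒪`, `Λ` is a `γ`-stable `ϖ^e·1`-self-dual lattice satisfying the level-`i`
predicate iff `Λ = Λ(T(k, y, −k−e))` is a self-dual Hermite lattice with `2k + e + i ≤ N` (★ (L5-d3) `mem_selfDualStable_smul_one_diag_iff` + §3).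
[cite: Flicker1998UnitaryFL, §6 p. 95] [cite: Macdonald1995, Ch. V §2] -/
theorem mem_selfDualStable_smul_one_diag_level_iff [IsDiscreteValuationRing 𝒪[F]] {s : F} {i : ℕ}
    (has : ϖ ^ (-(i : ℤ)) * (a - s) ∈ 𝒪[F]) (hcs : ϖ ^ (-(i : ℤ)) * (c - s) ∈ 𝒪[F]) (Λ : Submodule 𝒪[F] (Fin 2 → F)) :
    Λ ∈ {Λ : Submodule 𝒪[F] (Fin 2 → F) |
        ((∃ g : GL (Fin 2) F, (∃ J' ∈ glInt 2 F, (J' : Matrix (Fin 2) (Fin 2) F) = formCongr σ g ((ϖ ^ (e : ℤ)) • (1 : Matrix (Fin 2) (Fin 2) F))) ∧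
            Λ = Submodule.span 𝒪[F] (Set.range ((g : Matrix (Fin 2) (Fin 2) F))ᵀ)) ∧
          Λ.map ((Matrix.toLin' (γ : Matrix (Fin 2) (Fin 2) F)).restrictScalars 𝒪[F]) = Λ) ∧
        Λ.map ((Matrix.toLin' ((γ : Matrix (Fin 2) (Fin 2) F) - s • (1 : Matrix (Fin 2) (Fin 2) F))).restrictScalars 𝒪[F]) ≤
          Λ.map ((Matrix.toLin' (ϖ ^ i • (1 : Matrix (Fin 2) (Fin 2) F))).restrictScalars 𝒪[F])} ↔
      ∃ (k : ℤ) (y : F) (g : GL (Fin 2) F), (g : Matrix (Fin 2) (Fin 2) F) = !![ϖ ^ k, y; 0, ϖ ^ (-k - e)] ∧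
        (∃ J' ∈ glInt 2 F, (J' : Matrix (Fin 2) (Fin 2) F) = formCongr σ g ((ϖ ^ (e : ℤ)) • (1 : Matrix (Fin 2) (Fin 2) F))) ∧
        Λ = Submodule.span 𝒪[F] (Set.range ((g : Matrix (Fin 2) (Fin 2) F))ᵀ) ∧ 2 * k + e + i ≤ N := by
  constructor
  · rintro ⟨hS, hlev⟩
    obtain ⟨k, y, g, hg, hsd, hΛ, -⟩ := (mem_selfDualStable_smul_one_diag_iff hϖ hσϖ hσO γ hγ ha hc hN Λ).1 hS
    refine ⟨k, y, g, hg, hsd, hΛ, ?_⟩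
    rw [hΛ] at hlev
    exact ((map_sub_smul_one_le_iff_of_selfDual hϖ hσϖ hσO γ hγ hN s i g hg hsd).1 hlev).2.2
  · rintro ⟨k, y, g, hg, hsd, rfl, hle⟩
    exact ⟨(mem_selfDualStable_smul_one_diag_iff hϖ hσϖ hσO γ hγ ha hc hN _).2 ⟨k, y, g, hg, hsd, rfl, by omega⟩,
      (map_sub_smul_one_le_iff_of_selfDual hϖ hσϖ hσO γ hγ hN s i g hg hsd).2 ⟨has, hcs, hle⟩⟩

end Strata

/-! ## §4 The level-`i` ball count -/

section Count

variable {σ}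
variable (σO : 𝒪[F] →+* 𝒪[F]) (hσO' : ∀ x : 𝒪[F], ((σO x : 𝒪[F]) : F) = σ x) (hσσ : ∀ x, σO (σO x) = x)
  (hσϖ : σ ϖ = ϖ) {e : ℕ} (he : e ≤ 1)
  {a c : F} {N : ℕ} (γ : GL (Fin 2) F) (hγ : (γ : Matrix (Fin 2) (Fin 2) F) = !![a, 0; 0, c])
  (ha : valuation F a = 1) (hc : valuation F c = 1) (hN : valuation F (a - c) = valuation F (ϖ ^ N))

include hϖ hσO' hσσ hσϖ he hγ ha hc hN in
/-- **THE LEVEL-`i` BALL COUNT** (eigenframe gluing route, ★ (L5-d3) with one more conjunct): for `e ∈ {0, 1}`, `↑γ = diag(a, c)`, `|a| = |c| = 1`,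
`|a − c| = |ϖ^N|`, a scalar `s` with `ϖ^{−i}(a − s), ϖ^{−i}(c − s) ∈ 𝒪`, over a complete discretely valued `F` whose residue field of `𝒪` has `q²` elements and `σ` an
involution of `𝒪` moving some element by a unit: `#{Λ ∈ S(ϖ^e • 1, γ) | (γ − s·1)Λ ≤ ϖ^iΛ} = Σ_{j ≤ N, j ≡ e (2), j + i ≤ N} w(j)`, `w(0) = 1`, `w(j) = q^{j−1}(q+1)` —
the strata `k` with `2k + e = j`, `j + i ≤ N` (§3) are disjoint (★ uniqueness of the Hermite exponent), exhaust the set, and have `w(j)` elements (★ (L5-b)∕(L5-c)).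
On the tree: the number of type-`e` vertices of the ball `B(x_T, N − i)`. [cite: Flicker1998UnitaryFL, §6 p. 95 + REMARK] [cite: Kottwitz1988, §2] [cite: Serre1980Trees, Ch. II §1.1] -/
theorem ncard_selfDualStable_smul_one_diag_level_eq_sum [IsDiscreteValuationRing 𝒪[F]] [Finite (ResidueField 𝒪[F])]
    [IsAdicComplete (maximalIdeal 𝒪[F]) 𝒪[F]] {a₀ : 𝒪[F]} (ha₀ : IsUnit (σO a₀ - a₀)) {q : ℕ} (hq : Nat.card (ResidueField 𝒪[F]) = q ^ 2)
    {s : F} {i : ℕ} (has : ϖ ^ (-(i : ℤ)) * (a - s) ∈ 𝒪[F]) (hcs : ϖ ^ (-(i : ℤ)) * (c - s) ∈ 𝒪[F]) :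
    {Λ : Submodule 𝒪[F] (Fin 2 → F) |
        ((∃ g : GL (Fin 2) F, (∃ J' ∈ glInt 2 F, (J' : Matrix (Fin 2) (Fin 2) F) = formCongr σ g ((ϖ ^ (e : ℤ)) • (1 : Matrix (Fin 2) (Fin 2) F))) ∧
            Λ = Submodule.span 𝒪[F] (Set.range ((g : Matrix (Fin 2) (Fin 2) F))ᵀ)) ∧
          Λ.map ((Matrix.toLin' (γ : Matrix (Fin 2) (Fin 2) F)).restrictScalars 𝒪[F]) = Λ) ∧
        Λ.map ((Matrix.toLin' ((γ : Matrix (Fin 2) (Fin 2) F) - s • (1 : Matrix (Fin 2) (Fin 2) F))).restrictScalars 𝒪[F]) ≤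
          Λ.map ((Matrix.toLin' (ϖ ^ i • (1 : Matrix (Fin 2) (Fin 2) F))).restrictScalars 𝒪[F])}.ncard =
      ∑ j ∈ (range (N + 1)).filter (fun j => j % 2 = e ∧ j + i ≤ N), (if j = 0 then 1 else q ^ (j - 1) * (q + 1)) := by
  classical
  have hσO : ∀ x ∈ 𝒪[F], σ x ∈ 𝒪[F] := fun x hx => by rw [← hσO' ⟨x, hx⟩]; exact (σO ⟨x, hx⟩).2
  -- the strata, indexed by `j = 2k + e`, `k(j) := (j − e) / 2`
  set T : ℤ → Set (Submodule 𝒪[F] (Fin 2 → F)) := fun k =>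
    {Λ | ∃ (y : F) (g : GL (Fin 2) F), (g : Matrix (Fin 2) (Fin 2) F) = !![ϖ ^ k, y; 0, ϖ ^ (-k - e)] ∧
        (∃ J' ∈ glInt 2 F, (J' : Matrix (Fin 2) (Fin 2) F) = formCongr σ g ((ϖ ^ (e : ℤ)) • (1 : Matrix (Fin 2) (Fin 2) F))) ∧
        Λ = Submodule.span 𝒪[F] (Set.range ((g : Matrix (Fin 2) (Fin 2) F))ᵀ)} with hT
  set J : Finset ℕ := (range (N + 1)).filter (fun j => j % 2 = e ∧ j + i ≤ N) with hJ
  have hkj : ∀ j ∈ J, 2 * (((j - e) / 2 : ℕ) : ℤ) + e = (j : ℕ) ∧ j + i ≤ N := fun j hj => by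
    simp only [hJ, Finset.mem_filter, Finset.mem_range] at hj
    constructor <;> omega
  -- per-stratum value and finiteness
  have hval : ∀ j ∈ J, (T (((j - e) / 2 : ℕ) : ℤ)).ncard = if j = 0 then 1 else q ^ (j - 1) * (q + 1) := fun j hj => by
    have hjn : (2 * (((j - e) / 2 : ℕ) : ℤ) + (e : ℤ)).toNat = j := by have := (hkj j hj).1; omega
    refine (ncard_selfDual_hermite_eq_natCard hϖ σ hσϖ σO hσO' hσσ (k := (((j - e) / 2 : ℕ) : ℤ)) (e := (e : ℤ))
      (by have := (hkj j hj).1; omega)).trans ?_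
    rw [natCard_norm_fibre_neg_one_eq_gluingWeight σO hσσ ha₀ hq, hjn]
  have hq1 : 1 ≤ q := by
    rcases Nat.eq_zero_or_pos q with rfl | h
    · rw [zero_pow two_ne_zero] at hq
      exact absurd hq (Nat.card_pos (α := ResidueField 𝒪[F])).ne'
    · exact h
  have hfin : ∀ j ∈ J, (T (((j - e) / 2 : ℕ) : ℤ)).Finite := fun j hj => by
    refine Set.finite_of_ncard_ne_zero ?_
    rw [hval j hj]
    split_ifs
    · exact one_ne_zero
    · exact Nat.mul_ne_zero (pow_ne_zero _ (by omega)) (by omega)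
  -- the set is `⋃_{j ∈ J} T (k j)` as a finite `biUnion`
  set U : Finset (Submodule 𝒪[F] (Fin 2 → F)) := J.attach.biUnion fun j => (hfin j.1 j.2).toFinset with hU
  have hSU : {Λ : Submodule 𝒪[F] (Fin 2 → F) |
        ((∃ g : GL (Fin 2) F, (∃ J' ∈ glInt 2 F, (J' : Matrix (Fin 2) (Fin 2) F) = formCongr σ g ((ϖ ^ (e : ℤ)) • (1 : Matrix (Fin 2) (Fin 2) F))) ∧
            Λ = Submodule.span 𝒪[F] (Set.range ((g : Matrix (Fin 2) (Fin 2) F))ᵀ)) ∧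
          Λ.map ((Matrix.toLin' (γ : Matrix (Fin 2) (Fin 2) F)).restrictScalars 𝒪[F]) = Λ) ∧
        Λ.map ((Matrix.toLin' ((γ : Matrix (Fin 2) (Fin 2) F) - s • (1 : Matrix (Fin 2) (Fin 2) F))).restrictScalars 𝒪[F]) ≤
          Λ.map ((Matrix.toLin' (ϖ ^ i • (1 : Matrix (Fin 2) (Fin 2) F))).restrictScalars 𝒪[F])} =
      (U : Set (Submodule 𝒪[F] (Fin 2 → F))) := by
    ext Λ
    rw [mem_selfDualStable_smul_one_diag_level_iff hϖ hσϖ hσO γ hγ ha hc hN has hcs Λ, hU, Finset.coe_biUnion]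
    simp only [Finset.mem_coe, Finset.mem_attach, Set.iUnion_true, Set.mem_iUnion, Set.Finite.coe_toFinset]
    constructor
    · rintro ⟨k, y, g, hg, hsd, hΛ, hle⟩
      obtain ⟨-, hj0, -, -⟩ := (exists_mem_glInt_coe_eq_formCongr_hermite_iff hϖ σ hσϖ hσO g hg).1 hsd
      have hjJ : (2 * k + e).toNat ∈ J := by
        simp only [hJ, Finset.mem_filter, Finset.mem_range]
        refine ⟨by omega, by omega, by omega⟩
      refine ⟨⟨_, hjJ⟩, ?_⟩
      have hk : ((((2 * k + (e : ℤ)).toNat - e) / 2 : ℕ) : ℤ) = k := by omega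
      rw [hT]; simp only [Set.mem_setOf_eq]
      rw [hk]
      exact ⟨y, g, hg, hsd, hΛ⟩
    · rintro ⟨⟨j, hj⟩, hmem⟩
      rw [hT] at hmem; simp only [Set.mem_setOf_eq] at hmem
      obtain ⟨y, g, hg, hsd, hΛ⟩ := hmem
      exact ⟨_, y, g, hg, hsd, hΛ, by have := hkj j hj; omega⟩
  -- disjointness of the strata
  have hdisj : (↑J.attach : Set {j // j ∈ J}).PairwiseDisjoint fun j => (hfin j.1 j.2).toFinset := by
    rintro ⟨j, hj⟩ - ⟨j', hj'⟩ - hne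
    rw [Function.onFun, Set.Finite.disjoint_toFinset, Set.disjoint_left]
    rintro Λ hΛ hΛ'
    rw [hT] at hΛ hΛ'
    simp only [Set.mem_setOf_eq] at hΛ hΛ'
    obtain ⟨y, g, hg, -, hΛg⟩ := hΛ
    obtain ⟨y', g', hg', -, hΛg'⟩ := hΛ'
    have hk := eq_of_span_hermite_eq_span_hermite hϖ g g' hg hg' (hΛg.symm.trans hΛg')
    have h1 := (hkj j hj).1; have h2 := (hkj j' hj').1
    exact hne (Subtype.ext (show j = j' by omega))
  rw [hSU, Set.ncard_coe_finset, hU, Finset.card_biUnion hdisj, ← Finset.sum_attach J]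
  refine Finset.sum_congr rfl fun j _ => ?_
  rw [← Set.ncard_eq_toFinset_card _ (hfin j.1 j.2), hval j.1 j.2]

include hϖ hσO' hσσ hσϖ he hγ ha hc hN in
/-- **HYPOTHESIS-FREE FORM AT `s := c`** (B-p12 (g29)'s rescaled-element ∕ depth reading «`(γ − c·1)Λ ⊆ ϖ^iΛ`»): for EVERY level `i`,
`#{Λ ∈ S(ϖ^e • 1, γ) | (γ − c·1)Λ ≤ ϖ^iΛ} = Σ_{j ≤ N, j ≡ e (2), j + i ≤ N} w(j)` — for `i ≤ N` this is the main count (`ϖ^{−i}(a − c) ∈ 𝒪`, `c − c = 0`); for `i > N`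
the set is empty (§3: a member forces `i ≤ N`) and the sum is empty. [cite: Flicker1998UnitaryFL, §6 p. 95 + REMARK] [cite: Kottwitz1988, §2] -/
theorem ncard_selfDualStable_smul_one_diag_level_self_eq_sum [IsDiscreteValuationRing 𝒪[F]] [Finite (ResidueField 𝒪[F])]
    [IsAdicComplete (maximalIdeal 𝒪[F]) 𝒪[F]] {a₀ : 𝒪[F]} (ha₀ : IsUnit (σO a₀ - a₀)) {q : ℕ} (hq : Nat.card (ResidueField 𝒪[F]) = q ^ 2) (i : ℕ) :
    {Λ : Submodule 𝒪[F] (Fin 2 → F) |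
        ((∃ g : GL (Fin 2) F, (∃ J' ∈ glInt 2 F, (J' : Matrix (Fin 2) (Fin 2) F) = formCongr σ g ((ϖ ^ (e : ℤ)) • (1 : Matrix (Fin 2) (Fin 2) F))) ∧
            Λ = Submodule.span 𝒪[F] (Set.range ((g : Matrix (Fin 2) (Fin 2) F))ᵀ)) ∧
          Λ.map ((Matrix.toLin' (γ : Matrix (Fin 2) (Fin 2) F)).restrictScalars 𝒪[F]) = Λ) ∧
        Λ.map ((Matrix.toLin' ((γ : Matrix (Fin 2) (Fin 2) F) - c • (1 : Matrix (Fin 2) (Fin 2) F))).restrictScalars 𝒪[F]) ≤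
          Λ.map ((Matrix.toLin' (ϖ ^ i • (1 : Matrix (Fin 2) (Fin 2) F))).restrictScalars 𝒪[F])}.ncard =
      ∑ j ∈ (range (N + 1)).filter (fun j => j % 2 = e ∧ j + i ≤ N), (if j = 0 then 1 else q ^ (j - 1) * (q + 1)) := by
  have h0 := hϖ.ne_zero
  have hσO : ∀ x ∈ 𝒪[F], σ x ∈ 𝒪[F] := fun x hx => by rw [← hσO' ⟨x, hx⟩]; exact (σO ⟨x, hx⟩).2
  have hcs : ϖ ^ (-(i : ℤ)) * (c - c) ∈ 𝒪[F] := by rw [sub_self, mul_zero]; exact zero_mem _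
  by_cases hiN : i ≤ N
  · have has : ϖ ^ (-(i : ℤ)) * (a - c) ∈ 𝒪[F] := by
      rw [Valuation.mem_integer_iff, map_mul, hN, ← map_mul, ← zpow_natCast, ← zpow_add₀ h0, ← Valuation.mem_integer_iff,
        zpow_uniformizer_mem_integer_iff hϖ]
      omega
    exact ncard_selfDualStable_smul_one_diag_level_eq_sum hϖ σO hσO' hσσ hσϖ he γ hγ ha hc hN ha₀ hq has hcs
  · -- both sides vanish
    have hJ : (range (N + 1)).filter (fun j => j % 2 = e ∧ j + i ≤ N) = ∅ :=
      Finset.filter_eq_empty_iff.2 fun j _ h => hiN (by omega)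
    rw [hJ, Finset.sum_empty]
    have hS : {Λ : Submodule 𝒪[F] (Fin 2 → F) |
        ((∃ g : GL (Fin 2) F, (∃ J' ∈ glInt 2 F, (J' : Matrix (Fin 2) (Fin 2) F) = formCongr σ g ((ϖ ^ (e : ℤ)) • (1 : Matrix (Fin 2) (Fin 2) F))) ∧
            Λ = Submodule.span 𝒪[F] (Set.range ((g : Matrix (Fin 2) (Fin 2) F))ᵀ)) ∧
          Λ.map ((Matrix.toLin' (γ : Matrix (Fin 2) (Fin 2) F)).restrictScalars 𝒪[F]) = Λ) ∧
        Λ.map ((Matrix.toLin' ((γ : Matrix (Fin 2) (Fin 2) F) - c • (1 : Matrix (Fin 2) (Fin 2) F))).restrictScalars 𝒪[F]) ≤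
          Λ.map ((Matrix.toLin' (ϖ ^ i • (1 : Matrix (Fin 2) (Fin 2) F))).restrictScalars 𝒪[F])} = ∅ := by
      refine Set.subset_empty_iff.1 fun Λ hΛ => ?_
      obtain ⟨hS, hlev⟩ := hΛ
      obtain ⟨k, y, g, hg, hsd, hΛg, -⟩ := (mem_selfDualStable_smul_one_diag_iff hϖ hσϖ hσO γ hγ ha hc hN Λ).1 hS
      rw [hΛg] at hlev
      obtain ⟨has, -, -⟩ := (map_sub_smul_one_le_iff_of_selfDual hϖ hσϖ hσO γ hγ hN c i g hg hsd).1 hlev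
      exact hiN (le_of_zpow_neg_mul_sub_mem hϖ hN has hcs)
    rw [hS, Set.ncard_empty]

include hϖ hσO' hσσ hσϖ he hγ ha hc hN in
/-- **HYPOTHESIS-FREE FORM AT `s := a`** (A-p16 (g27)'s `γ₁`-reading «`t ∈ γ₁·K_i(Λ)`»): for EVERY level `i`,
`#{Λ ∈ S(ϖ^e • 1, γ) | (γ − a·1)Λ ≤ ϖ^iΛ} = Σ_{j ≤ N, j ≡ e (2), j + i ≤ N} w(j)`. [cite: Flicker1998UnitaryFL, §6 p. 95 + REMARK] [cite: Kottwitz1988, §2] -/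
theorem ncard_selfDualStable_smul_one_diag_level_self_eq_sum' [IsDiscreteValuationRing 𝒪[F]] [Finite (ResidueField 𝒪[F])]
    [IsAdicComplete (maximalIdeal 𝒪[F]) 𝒪[F]] {a₀ : 𝒪[F]} (ha₀ : IsUnit (σO a₀ - a₀)) {q : ℕ} (hq : Nat.card (ResidueField 𝒪[F]) = q ^ 2) (i : ℕ) :
    {Λ : Submodule 𝒪[F] (Fin 2 → F) |
        ((∃ g : GL (Fin 2) F, (∃ J' ∈ glInt 2 F, (J' : Matrix (Fin 2) (Fin 2) F) = formCongr σ g ((ϖ ^ (e : ℤ)) • (1 : Matrix (Fin 2) (Fin 2) F))) ∧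
            Λ = Submodule.span 𝒪[F] (Set.range ((g : Matrix (Fin 2) (Fin 2) F))ᵀ)) ∧
          Λ.map ((Matrix.toLin' (γ : Matrix (Fin 2) (Fin 2) F)).restrictScalars 𝒪[F]) = Λ) ∧
        Λ.map ((Matrix.toLin' ((γ : Matrix (Fin 2) (Fin 2) F) - a • (1 : Matrix (Fin 2) (Fin 2) F))).restrictScalars 𝒪[F]) ≤
          Λ.map ((Matrix.toLin' (ϖ ^ i • (1 : Matrix (Fin 2) (Fin 2) F))).restrictScalars 𝒪[F])}.ncard =
      ∑ j ∈ (range (N + 1)).filter (fun j => j % 2 = e ∧ j + i ≤ N), (if j = 0 then 1 else q ^ (j - 1) * (q + 1)) := by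
  have h0 := hϖ.ne_zero
  have hσO : ∀ x ∈ 𝒪[F], σ x ∈ 𝒪[F] := fun x hx => by rw [← hσO' ⟨x, hx⟩]; exact (σO ⟨x, hx⟩).2
  have has : ϖ ^ (-(i : ℤ)) * (a - a) ∈ 𝒪[F] := by rw [sub_self, mul_zero]; exact zero_mem _
  by_cases hiN : i ≤ N
  · have hcs : ϖ ^ (-(i : ℤ)) * (c - a) ∈ 𝒪[F] := by
      rw [← neg_sub, mul_neg, neg_mem_iff, Valuation.mem_integer_iff, map_mul, hN, ← map_mul, ← zpow_natCast, ← zpow_add₀ h0,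
        ← Valuation.mem_integer_iff, zpow_uniformizer_mem_integer_iff hϖ]
      omega
    exact ncard_selfDualStable_smul_one_diag_level_eq_sum hϖ σO hσO' hσσ hσϖ he γ hγ ha hc hN ha₀ hq has hcs
  · -- both sides vanish
    have hJ : (range (N + 1)).filter (fun j => j % 2 = e ∧ j + i ≤ N) = ∅ :=
      Finset.filter_eq_empty_iff.2 fun j _ h => hiN (by omega)
    rw [hJ, Finset.sum_empty]
    have hS : {Λ : Submodule 𝒪[F] (Fin 2 → F) |
        ((∃ g : GL (Fin 2) F, (∃ J' ∈ glInt 2 F, (J' : Matrix (Fin 2) (Fin 2) F) = formCongr σ g ((ϖ ^ (e : ℤ)) • (1 : Matrix (Fin 2) (Fin 2) F))) ∧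
            Λ = Submodule.span 𝒪[F] (Set.range ((g : Matrix (Fin 2) (Fin 2) F))ᵀ)) ∧
          Λ.map ((Matrix.toLin' (γ : Matrix (Fin 2) (Fin 2) F)).restrictScalars 𝒪[F]) = Λ) ∧
        Λ.map ((Matrix.toLin' ((γ : Matrix (Fin 2) (Fin 2) F) - a • (1 : Matrix (Fin 2) (Fin 2) F))).restrictScalars 𝒪[F]) ≤
          Λ.map ((Matrix.toLin' (ϖ ^ i • (1 : Matrix (Fin 2) (Fin 2) F))).restrictScalars 𝒪[F])} = ∅ := by
      refine Set.subset_empty_iff.1 fun Λ hΛ => ?_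
      obtain ⟨hS, hlev⟩ := hΛ
      obtain ⟨k, y, g, hg, hsd, hΛg, -⟩ := (mem_selfDualStable_smul_one_diag_iff hϖ hσϖ hσO γ hγ ha hc hN Λ).1 hS
      rw [hΛg] at hlev
      obtain ⟨-, hcs, -⟩ := (map_sub_smul_one_le_iff_of_selfDual hϖ hσϖ hσO γ hγ hN a i g hg hsd).1 hlev
      exact hiN (le_of_zpow_neg_mul_sub_mem hϖ hN has hcs)
    rw [hS, Set.ncard_empty]

end Count

end Literature.NumberTheory.Automorphic

end
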